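import Mathlib.FieldTheory.Finite.Basic
import Mathlib.RingTheory.RootsOfUnity.PrimitiveRoots
import Mathlib.LinearAlgebra.Matrix.Trace
import Mathlib.LinearAlgebra.Matrix.ToLin
import Mathlib.LinearAlgebra.LinearIndependent.Lemmas
import Mathlib.Algebra.CharP.Lemmas
import Mathlib.Algebra.Polynomial.Roots
import Mathlib.NumberTheory.Cyclotomic.PrimitiveRoots
import HarnessLib

/-!
# Semisimple group rings: a representation of `ℤ/g` over `𝔽_q` with the regular character is regular
  [Schoof2009, Chapter 13]

[Schoof2009, Chapter 13] ("Semisimple group rings") proves, for a finite abelian group `Γ` and a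
prime `q ∤ #Γ`, that two `ℤ`-free `ℤ[Γ]`-modules which become isomorphic over `ℝ` are isomorphic
modulo `q` ([Schoof2009, Lemmas 13.3, 13.4, Corollary 13.5]) and applies this to the `p`-units of
`ℚ(ζ_p)` ([Schoof2009, Proposition 13.7]: `E_p/E_p^q` is a free `𝔽_q[G⁺]`-module of rank one,
`G⁺` cyclic of order `g = (p-1)/2`). For the tree's route to Proposition 13.7 we isolate the
linear-algebraic kernel in a form that only needs the *traces* of the group elements (integers,
which reduce modulo `q`; this replaces [Schoof2009, Lemmas 13.3–13.5]):

* `Catalan.Semisimple.exists_linearIndependent_mulVec` — **let `Γ = ℤ/g` act on `𝔽_q^n`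
  (`q ∤ g`, `q` prime) through matrices `ρ(a)` (`ρ(0) = 1`, `ρ(a+b) = ρ(a)ρ(b)`) with
  `tr ρ(a) = g` for `a = 0` and `tr ρ(a) = 0` otherwise (the regular character). Then there is
  `w ∈ 𝔽_q^n` such that the vectors `ρ(a) w`, `a ∈ ℤ/g`, are linearly independent over `𝔽_q`**;
  with `#n = g` this says that `𝔽_q^n` is the free `𝔽_q[Γ]`-module of rank one generated by `w`.

Proof (the character theory of [Schoof2009, Ch. 13, pp. 85–86] over an extension `F ⊇ 𝔽_q` with a
primitive `g`-th root of unity `ω`): with `χ_j(a) = ω^{ja}` and `P_j = g⁻¹ ∑_a χ_j(-a) ρ(a)` one has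
`ρ(b) P_j = χ_j(b) P_j`, `P_k P_j = [k = j] P_j`, `∑_j P_j = 1` and `tr P_j = g⁻¹∑_a χ_j(-a) tr ρ(a) = 1`,
so every `P_j ≠ 0`. The Frobenius `x ↦ x^q` maps `P_j v` to `P_{qj} v` for `𝔽_q`-rational `v`;
summing `P_j` over the Frobenius orbits gives `𝔽_q`-rational projectors, whence an `𝔽_q`-rational
`w` with `P_j w ≠ 0` for *all* `j`; then `∑_a c_a ρ(a) w = 0` forces all `∑_a c_a χ_j(a) = 0` and
`c = 0` by Fourier inversion.

Everything is proved; the only definitions are `chi`, `proj`, `rhoF`, `frobVec`, `orbit`.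

## References

* R. Schoof, *Catalan's Conjecture*, Universitext, Springer 2009 [Schoof2009], Chapter 13
  (Proposition 13.1, Lemma 13.3, Corollary 13.5, Proposition 13.7; book pp. 85–90) — held,
  `lit read book:schoof2009-catalan-s-conjecture` (PDF pp. 163–168).
-/

namespace Literature.NumberTheory.DiophantineGeometry

namespace Catalan.Semisimple

open Finset Matrix

variable {g : ℕ} {F : Type*} [Field F]
variable {n : Type*} [Fintype n] [DecidableEq n]

/-! ### Powers of a primitive `g`-th root of unity indexed by `ℤ/g`, and the characters `χ_j` -/

section Characters

variable {ω : F} (hω : IsPrimitiveRoot ω g)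

include hω in
/-- `ω^x = ω^y` when `x ≡ y (mod g)`. [folklore] -/
theorem pow_eq_pow_of_mod_eq {x y : ℕ} (h : x % g = y % g) : ω ^ x = ω ^ y := by
  rw [← Nat.mod_add_div x g, ← Nat.mod_add_div y g, pow_add, pow_add, pow_mul, pow_mul,
    hω.pow_eq_one, one_pow, one_pow, h]

variable [NeZero g]

include hω in
/-- `ω^{(a+b).val} = ω^{a.val} ω^{b.val}`. [folklore] -/
theorem pow_val_add (a b : ZMod g) : ω ^ (a + b).val = ω ^ a.val * ω ^ b.val := by
  rw [← pow_add]
  apply pow_eq_pow_of_mod_eq hω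
  rw [ZMod.val_add, Nat.mod_mod]

include hω in
omit [NeZero g] in
/-- `ω^{(ab).val} = ω^{a.val b.val}`. [folklore] -/
theorem pow_val_mul [NeZero g] (a b : ZMod g) : ω ^ (a * b).val = ω ^ (a.val * b.val) := by
  apply pow_eq_pow_of_mod_eq hω
  rw [ZMod.val_mul, Nat.mod_mod]

include hω in
/-- `ω^{(-a).val} ω^{a.val} = 1`. [folklore] -/
theorem pow_val_neg_mul (a : ZMod g) : ω ^ (-a).val * ω ^ a.val = 1 := by
  rw [← pow_val_add hω, neg_add_cancel, ZMod.val_zero, pow_zero]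

/-- **The characters of `ℤ/g`**: `χ_j(a) = ω^{ja}`. [cite: Schoof2009, Ch. 13 (p. 85)] -/
noncomputable def chi (ω : F) (j a : ZMod g) : F := ω ^ (j * a).val

omit [NeZero g] in
/-- `χ_j(a) = χ_a(j)`. [folklore] -/
theorem chi_comm [NeZero g] (j a : ZMod g) : chi ω j a = chi ω a j := by
  unfold chi; rw [mul_comm]

include hω in
/-- `χ_j(a + b) = χ_j(a) χ_j(b)`. [folklore] -/
theorem chi_add (j a b : ZMod g) : chi ω j (a + b) = chi ω j a * chi ω j b := by
  unfold chi; rw [mul_add, pow_val_add hω]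

include hω in
/-- `χ_{j+k}(a) = χ_j(a) χ_k(a)`. [folklore] -/
theorem chi_add_left (j k a : ZMod g) : chi ω (j + k) a = chi ω j a * chi ω k a := by
  rw [chi_comm, chi_add hω, chi_comm a, chi_comm a]

omit [NeZero g] in
/-- `χ_j(0) = 1`. [folklore] -/
theorem chi_zero [NeZero g] (j : ZMod g) : chi ω j 0 = 1 := by
  unfold chi; rw [mul_zero, ZMod.val_zero, pow_zero]

include hω in
/-- `χ_j(-a) χ_j(a) = 1`. [folklore] -/
theorem chi_neg_mul (j a : ZMod g) : chi ω j (-a) * chi ω j a = 1 := by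
  unfold chi; rw [mul_neg, pow_val_neg_mul hω]

include hω in
/-- `χ_j(a) ≠ 0`. [folklore] -/
theorem chi_ne_zero (j a : ZMod g) : chi ω j a ≠ 0 := by
  intro h
  have := chi_neg_mul hω j a
  rw [h, mul_zero] at this
  exact zero_ne_one this

include hω in
/-- `χ_k(-a) χ_j(a) = χ_{j-k}(a)`. [folklore] -/
theorem chi_neg_mul_chi (j k a : ZMod g) : chi ω k (-a) * chi ω j a = chi ω (j - k) a := by
  rw [sub_eq_add_neg, chi_add_left hω, mul_comm]
  congr 1
  unfold chi; rw [neg_mul, mul_neg]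

include hω in
/-- `χ_j(-b) χ_j(a) = χ_j(a - b)`. [folklore] -/
theorem chi_neg_mul_chi' (j a b : ZMod g) : chi ω j (-b) * chi ω j a = chi ω j (a - b) := by
  rw [sub_eq_add_neg, chi_add hω, mul_comm]

include hω in
/-- `χ_j(a)^m = χ_{mj}(a)` for a natural number `m` — used with `m = q` (the Frobenius).
[folklore] -/
theorem chi_pow_natCast (m : ℕ) (j a : ZMod g) : chi ω j a ^ m = chi ω ((m : ZMod g) * j) a := by
  unfold chi
  rw [← pow_mul, mul_assoc, pow_val_mul hω (m : ZMod g), ZMod.val_natCast]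
  apply pow_eq_pow_of_mod_eq hω
  rw [mul_comm]
  exact ((Nat.mod_modEq m g).mul_right _).symm

omit [NeZero g] in
/-- sums over `ℤ/g` are sums over `range g` of the representatives. [folklore] -/
theorem sum_zmod_eq_sum_range [NeZero g] {M : Type*} [AddCommMonoid M] (f : ℕ → M) :
    ∑ a : ZMod g, f a.val = ∑ i ∈ range g, f i := by
  classical
  have himage : (Finset.univ : Finset (ZMod g)).image (fun a : ZMod g => a.val) = range g := by
    ext i
    simp only [Finset.mem_image, Finset.mem_univ, true_and, Finset.mem_range]
    constructor
    · rintro ⟨a, rfl⟩; exact ZMod.val_lt a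
    · intro hi; exact ⟨(i : ZMod g), by rw [ZMod.val_natCast, Nat.mod_eq_of_lt hi]⟩
  rw [← himage, Finset.sum_image]
  intro a _ b _ h
  exact ZMod.val_injective g h

include hω in
/-- **Orthogonality**: `∑_a χ_j(a) = g` if `j = 0` and `= 0` otherwise. [cite: Schoof2009, Ch. 13 (p. 85)] -/
theorem sum_chi (j : ZMod g) : ∑ a : ZMod g, chi ω j a = if j = 0 then (g : F) else 0 := by
  have e : ∀ a : ZMod g, chi ω j a = (fun i => (ω ^ j.val) ^ i) a.val := by
    intro a; unfold chi; rw [pow_val_mul hω, pow_mul]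
  rw [Finset.sum_congr rfl (fun a _ => e a), sum_zmod_eq_sum_range]
  split_ifs with hj
  · rw [hj, ZMod.val_zero, pow_zero]
    simp
  · have hx1 : ω ^ j.val ≠ 1 := by
      intro h
      apply hj
      have hdvd : g ∣ j.val := (hω.pow_eq_one_iff_dvd j.val).mp h
      have : j.val = 0 := Nat.eq_zero_of_dvd_of_lt hdvd (ZMod.val_lt j)
      rwa [ZMod.val_eq_zero] at this
    have hxg : (ω ^ j.val) ^ g = 1 := by rw [← pow_mul, mul_comm, pow_mul, hω.pow_eq_one, one_pow]
    have h := geom_sum_mul (ω ^ j.val) g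
    rw [hxg, sub_self] at h
    exact (mul_eq_zero.mp h).resolve_right (sub_ne_zero.mpr hx1)

include hω in
/-- the dual orthogonality `∑_j χ_j(a) = g [a = 0]`. [folklore] -/
theorem sum_chi_left (a : ZMod g) : ∑ j : ZMod g, chi ω j a = if a = 0 then (g : F) else 0 := by
  rw [show ∑ j : ZMod g, chi ω j a = ∑ j : ZMod g, chi ω a j from
    Finset.sum_congr rfl fun j _ => chi_comm j a]
  exact sum_chi hω a

include hω in
/-- **Fourier inversion**: if `∑_a c_a χ_j(a) = 0` for all `j` then `c = 0` (given `g ≠ 0` in `F`).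
[folklore] -/
theorem eq_zero_of_forall_sum_chi_eq_zero (hg : (g : F) ≠ 0) {c : ZMod g → F}
    (h : ∀ j : ZMod g, ∑ a : ZMod g, c a * chi ω j a = 0) : c = 0 := by
  funext b
  have key : ∑ j : ZMod g, chi ω j (-b) * ∑ a : ZMod g, c a * chi ω j a = (g : F) * c b := by
    simp_rw [Finset.mul_sum]
    rw [Finset.sum_comm]
    simp_rw [show ∀ (a j : ZMod g), chi ω j (-b) * (c a * chi ω j a) = c a * chi ω j (a - b) from
      fun a j => by rw [← chi_neg_mul_chi' hω]; ring, ← Finset.mul_sum, sum_chi_left hω,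
      sub_eq_zero, mul_ite, mul_zero]
    rw [Finset.sum_ite_eq']
    simp [mul_comm]
  simp_rw [h, mul_zero, Finset.sum_const_zero] at key
  exact (mul_eq_zero.mp key.symm).resolve_left hg

end Characters

/-! ### The projectors `P_j` -/

section Projectors

variable [NeZero g] {ω : F} (hω : IsPrimitiveRoot ω g)

/-- **The projectors** `P_j = g⁻¹ ∑_a χ_j(-a) ρ(a)` onto the `χ_j`-eigenspaces of a representation
`ρ` of `ℤ/g`. [cite: Schoof2009, Ch. 13 (p. 85, the idempotents of `k[Γ] ≅ ∏ k_χ`)] -/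
noncomputable def proj (ρ : ZMod g → Matrix n n F) (ω : F) (j : ZMod g) : Matrix n n F :=
  (g : F)⁻¹ • ∑ a : ZMod g, chi ω j (-a) • ρ a

variable {ρ : ZMod g → Matrix n n F} (hρ : ∀ a b, ρ (a + b) = ρ a * ρ b)

include hρ in
omit [DecidableEq n] [NeZero g] in
/-- the `ρ(a)` commute. [folklore] -/
theorem rho_comm [NeZero g] (a b : ZMod g) : ρ a * ρ b = ρ b * ρ a := by rw [← hρ, ← hρ, add_comm]

include hω hρ in
omit [DecidableEq n] in
/-- `∑_a χ_j(-a) ρ(a + b) = χ_j(b) ∑_a χ_j(-a) ρ(a)` (reindexing). [folklore] -/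
theorem sum_chi_smul_rho_add (b j : ZMod g) :
    ∑ a : ZMod g, ρ b * (chi ω j (-a) • ρ a) = chi ω j b • ∑ a : ZMod g, chi ω j (-a) • ρ a := by
  have e1 : ∀ a : ZMod g, ρ b * (chi ω j (-a) • ρ a) =
      (fun c => chi ω j (-(c - b)) • ρ c) (Equiv.addRight b a) := by
    intro a
    simp only [Equiv.coe_addRight, add_sub_cancel_right]
    rw [Matrix.mul_smul, hρ, rho_comm hρ a b]
  rw [Fintype.sum_equiv (Equiv.addRight b) _ (fun c => chi ω j (-(c - b)) • ρ c) e1, Finset.smul_sum]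
  refine Finset.sum_congr rfl fun c _ => ?_
  rw [smul_smul, neg_sub, show b - c = b + -c by ring, chi_add hω]

include hω hρ in
omit [DecidableEq n] in
/-- `ρ(b) P_j = χ_j(b) P_j`. [cite: Schoof2009, Ch. 13 (p. 85)] -/
theorem mul_proj (b j : ZMod g) : ρ b * proj ρ ω j = chi ω j b • proj ρ ω j := by
  unfold proj
  rw [Matrix.mul_smul, Finset.mul_sum, sum_chi_smul_rho_add hω hρ, smul_comm]

include hω hρ in
omit [DecidableEq n] in
/-- `P_j ρ(b) = χ_j(b) P_j`. [folklore] -/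
theorem proj_mul (b j : ZMod g) : proj ρ ω j * ρ b = chi ω j b • proj ρ ω j := by
  rw [← mul_proj hω hρ]
  unfold proj
  rw [Matrix.smul_mul, Matrix.mul_smul, Finset.sum_mul, Finset.mul_sum]
  congr 1
  exact Finset.sum_congr rfl fun a _ => by rw [Matrix.smul_mul, Matrix.mul_smul, rho_comm hρ]

include hω in
omit [DecidableEq n] in
/-- `P_k u = [k = j] u` for a `χ_j`-eigenvector `u`. [cite: Schoof2009, Ch. 13 (p. 85)] -/
theorem proj_mulVec_eigenvector (hg : (g : F) ≠ 0) {j : ZMod g} {u : n → F}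
    (hu : ∀ b, (ρ b).mulVec u = chi ω j b • u) (k : ZMod g) :
    (proj ρ ω k).mulVec u = if k = j then u else 0 := by
  unfold proj
  rw [Matrix.smul_mulVec, Matrix.sum_mulVec]
  simp_rw [Matrix.smul_mulVec, hu, smul_smul, ← Finset.sum_smul, chi_neg_mul_chi hω,
    sum_chi hω, sub_eq_zero]
  by_cases h : j = k
  · rw [if_pos h, if_pos h.symm, smul_smul, inv_mul_cancel₀ hg, one_smul]
  · rw [if_neg h, if_neg (Ne.symm h), zero_smul, smul_zero]

include hω hρ in
omit [DecidableEq n] in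
/-- the columns of `P_j` are `χ_j`-eigenvectors. [folklore] -/
theorem mulVec_proj_col (b j : ZMod g) (l : n) :
    (ρ b).mulVec (fun m => proj ρ ω j m l) = chi ω j b • fun m => proj ρ ω j m l := by
  funext i
  have h := congrFun (congrFun (mul_proj hω hρ b j) i) l
  rw [Matrix.mul_apply, Matrix.smul_apply, smul_eq_mul] at h
  simpa [Matrix.mulVec, dotProduct] using h

include hω hρ in
omit [DecidableEq n] in
/-- **`P_k P_j = [k = j] P_j`** (orthogonal idempotents). [cite: Schoof2009, Ch. 13 (p. 85)] -/
theorem proj_mul_proj (hg : (g : F) ≠ 0) (k j : ZMod g) :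
    proj ρ ω k * proj ρ ω j = if k = j then proj ρ ω j else 0 := by
  ext i l
  have h := congrFun (proj_mulVec_eigenvector hω hg (mulVec_proj_col hω hρ · j l) k) i
  rw [Matrix.mul_apply]
  simp only [Matrix.mulVec, dotProduct] at h
  rw [h]
  split_ifs <;> rfl

include hω in
omit [Fintype n] in
/-- `∑_j P_j = 1`. [cite: Schoof2009, Ch. 13 (p. 85)] -/
theorem sum_proj (hg : (g : F) ≠ 0) (hρ0 : ρ 0 = 1) : ∑ j : ZMod g, proj ρ ω j = 1 := by
  unfold proj
  rw [← Finset.smul_sum, Finset.sum_comm]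
  simp_rw [← Finset.sum_smul]
  rw [show ∑ a : ZMod g, (∑ j : ZMod g, chi ω j (-a)) • ρ a =
      ∑ a : ZMod g, (if a = 0 then (g : F) • ρ 0 else 0) from
    Finset.sum_congr rfl fun a _ => by
      rw [sum_chi_left hω]
      by_cases h : a = 0
      · subst h; simp
      · rw [if_neg (neg_ne_zero.mpr h), if_neg h, zero_smul]]
  rw [Finset.sum_ite_eq', if_pos (Finset.mem_univ _), smul_smul, inv_mul_cancel₀ hg, one_smul, hρ0]

omit [DecidableEq n] in
/-- **`tr P_j = 1`** when `ρ` has the regular character.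
[cite: Schoof2009, Lemma 13.3 (here replaced by traces)] -/
theorem trace_proj (hg : (g : F) ≠ 0)
    (htr : ∀ a : ZMod g, (ρ a).trace = if a = 0 then (g : F) else 0) (j : ZMod g) :
    (proj ρ ω j).trace = 1 := by
  unfold proj
  rw [Matrix.trace_smul, Matrix.trace_sum]
  simp_rw [Matrix.trace_smul, htr, smul_ite, smul_zero]
  rw [Finset.sum_ite_eq', if_pos (Finset.mem_univ _), neg_zero, chi_zero, one_smul,
    smul_eq_mul, inv_mul_cancel₀ hg]

omit [DecidableEq n] in
/-- every `P_j` is non-zero. [cite: Schoof2009, Ch. 13 (p. 86)] -/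
theorem proj_ne_zero (hg : (g : F) ≠ 0)
    (htr : ∀ a : ZMod g, (ρ a).trace = if a = 0 then (g : F) else 0) (j : ZMod g) :
    proj ρ ω j ≠ 0 := by
  intro h
  have := trace_proj (ω := ω) hg htr j
  rw [h, Matrix.trace_zero] at this
  exact zero_ne_one this

end Projectors

/-! ### The Frobenius and `𝔽_q`-rational vectors -/

section Frobenius

variable {q : ℕ} [hq : Fact q.Prime] [Algebra (ZMod q) F]

/-- the Frobenius on vectors, `(v_i) ↦ (v_i^q)`. [folklore] -/
def frobVec (q : ℕ) (v : n → F) : n → F := fun i => v i ^ q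

omit [Fintype n] [DecidableEq n] [Algebra (ZMod q) F] in
/-- `frobVec` is injective (on a field). [folklore] -/
theorem frobVec_eq_zero_iff (v : n → F) : frobVec q v = 0 ↔ v = 0 := by
  constructor
  · intro h; funext i
    exact pow_eq_zero_iff hq.out.ne_zero |>.mp (congrFun h i)
  · rintro rfl; funext i; exact zero_pow hq.out.ne_zero

omit [Fintype n] [DecidableEq n] in
/-- vectors with coordinates in `𝔽_q` are Frobenius-fixed. [folklore] -/
theorem frobVec_algebraMap (v : n → ZMod q) :
    frobVec q (fun i => algebraMap (ZMod q) F (v i)) = fun i => algebraMap (ZMod q) F (v i) := by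
  funext i
  show algebraMap (ZMod q) F (v i) ^ q = _
  rw [← map_pow, ZMod.pow_card]

omit [Fintype n] [Algebra (ZMod q) F] in
/-- the standard basis vectors are Frobenius-fixed. [folklore] -/
theorem frobVec_single (i : n) : frobVec q (Pi.single i (1 : F) : n → F) = Pi.single i 1 := by
  funext l
  simp only [frobVec, Pi.single_apply]
  split_ifs
  · exact one_pow q
  · exact zero_pow hq.out.ne_zero

/-- a Frobenius-fixed element of `F` lies in `𝔽_q` (the `q` elements of `𝔽_q` exhaust the roots of
`X^q - X`). [folklore] -/
theorem exists_algebraMap_eq_of_pow_eq {x : F} (hx : x ^ q = x) :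
    ∃ c : ZMod q, algebraMap (ZMod q) F c = x := by
  classical
  set P : Polynomial F := Polynomial.X ^ q - Polynomial.X with hP
  have hP0 : P ≠ 0 := FiniteField.X_pow_card_sub_X_ne_zero F hq.out.one_lt
  have hdeg : P.natDegree = q := FiniteField.X_pow_card_sub_X_natDegree_eq F hq.out.one_lt
  have hroot : ∀ y : F, y ^ q = y → y ∈ P.roots := by
    intro y hy
    rw [Polynomial.mem_roots hP0, Polynomial.IsRoot, hP, Polynomial.eval_sub, Polynomial.eval_pow,
      Polynomial.eval_X, hy, sub_self]
  by_contra hne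
  push Not at hne
  have hsub : (Finset.univ.image (algebraMap (ZMod q) F) ∪ {x}).val ≤ P.roots := by
    rw [Multiset.le_iff_subset (Finset.nodup _)]
    intro y hy
    rw [Finset.mem_val, Finset.mem_union, Finset.mem_image, Finset.mem_singleton] at hy
    rcases hy with ⟨c, -, rfl⟩ | rfl
    · exact hroot _ (by rw [← map_pow, ZMod.pow_card])
    · exact hroot _ hx
  have hcard := (Multiset.card_le_card hsub).trans (Polynomial.card_roots' P)
  rw [hdeg, Finset.card_val, Finset.card_union_of_disjoint, Finset.card_singleton,
    Finset.card_image_of_injective _ (algebraMap (ZMod q) F).injective, Finset.card_univ,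
    ZMod.card] at hcard
  · omega
  · rw [Finset.disjoint_singleton_right, Finset.mem_image]
    rintro ⟨c, -, hc⟩
    exact hne c hc

omit [Fintype n] [DecidableEq n] in
/-- a Frobenius-fixed vector has coordinates in `𝔽_q`. [folklore] -/
theorem exists_eq_algebraMap_of_frobVec_eq {v : n → F} (hv : frobVec q v = v) :
    ∃ v₀ : n → ZMod q, v = fun i => algebraMap (ZMod q) F (v₀ i) := by
  have h : ∀ i, ∃ c : ZMod q, algebraMap (ZMod q) F c = v i :=
    fun i => exists_algebraMap_eq_of_pow_eq (congrFun hv i)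
  choose v₀ hv₀ using h
  exact ⟨v₀, funext fun i => (hv₀ i).symm⟩

variable (F) in
/-- the representation `ρ₀ : ℤ/g → M_n(𝔽_q)` with scalars extended to `F`. [folklore] -/
def rhoF (ρ₀ : ZMod g → Matrix n n (ZMod q)) : ZMod g → Matrix n n F :=
  fun a => (ρ₀ a).map (algebraMap (ZMod q) F)

variable [CharP F q]

omit [DecidableEq n] in
/-- Frobenius commutes with `𝔽_q`-rational matrices. [folklore] -/
theorem frobVec_mulVec_map (A : Matrix n n (ZMod q)) (v : n → F) :
    frobVec q ((A.map (algebraMap (ZMod q) F)).mulVec v) =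
      (A.map (algebraMap (ZMod q) F)).mulVec (frobVec q v) := by
  haveI : ExpChar F q := ExpChar.prime hq.out
  funext i
  simp only [frobVec, Matrix.mulVec, dotProduct, Matrix.map_apply]
  rw [sum_pow_char]
  refine Finset.sum_congr rfl fun l _ => ?_
  rw [mul_pow, ← map_pow, ZMod.pow_card]

variable [NeZero g] {ω : F} (hω : IsPrimitiveRoot ω g) (ρ₀ : ZMod g → Matrix n n (ZMod q))

include hω in
omit [DecidableEq n] in
/-- **Frobenius twists the projectors**: `(P_j v)^{(q)} = P_{qj} v^{(q)}`.
[cite: Schoof2009, Ch. 13 (p. 86: the action of Galois on the characters)] -/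
theorem frobVec_proj_mulVec (v : n → F) (j : ZMod g) :
    frobVec q ((proj (rhoF F ρ₀) ω j).mulVec v) =
      (proj (rhoF F ρ₀) ω ((q : ZMod g) * j)).mulVec (frobVec q v) := by
  haveI : ExpChar F q := ExpChar.prime hq.out
  have hgq : ((g : F)) ^ q = g := by
    rw [← map_natCast (algebraMap (ZMod q) F), ← map_pow, ZMod.pow_card]
  funext i
  simp only [proj, frobVec, Matrix.smul_mulVec, Matrix.sum_mulVec, Pi.smul_apply, Finset.sum_apply,
    smul_eq_mul]
  rw [mul_pow, sum_pow_char, inv_pow, hgq]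
  congr 1
  refine Finset.sum_congr rfl fun a _ => ?_
  rw [mul_pow, chi_pow_natCast hω q j (-a)]
  congr 1
  exact congrFun (frobVec_mulVec_map (ρ₀ a) v) i

end Frobenius

/-! ### Frobenius orbits in `ℤ/g` and an `𝔽_q`-rational vector seen by every projector -/

section Orbits

variable {q : ℕ} [hq : Fact q.Prime] [Algebra (ZMod q) F] [CharP F q] [NeZero g]

omit [NeZero g] in
/-- `q` is a unit modulo `g` when `q ∤ g`. [folklore] -/
theorem coprime_q (hqg : ¬ q ∣ g) : Nat.Coprime q g :=
  (Nat.Prime.coprime_iff_not_dvd hq.out).mpr hqg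

/-- some power of `q` is `1` modulo `g`: `q^{N} = 1` with `N` the order of the unit `q`. [folklore] -/
theorem exists_pow_q_eq_one (hqg : ¬ q ∣ g) : ∃ N : ℕ, 0 < N ∧ (q : ZMod g) ^ N = 1 := by
  set u : (ZMod g)ˣ := ZMod.unitOfCoprime q (coprime_q hqg) with hu
  refine ⟨orderOf u, orderOf_pos u, ?_⟩
  rw [show (q : ZMod g) = (u : ZMod g) by rw [hu, ZMod.coe_unitOfCoprime], ← Units.val_pow_eq_pow_val,
    pow_orderOf_eq_one, Units.val_one]

/-- **the Frobenius orbit** of `j ∈ ℤ/g`: `{q^k j : k ≥ 0}` (all `k < #ℤ/g + 1` suffice).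
[cite: Schoof2009, Ch. 13 (p. 86)] -/
noncomputable def orbit (q : ℕ) (j : ZMod g) : Finset (ZMod g) :=
  (Finset.range (g + 1)).image fun k => ((q : ZMod g) ^ k) * j

omit hq [Algebra (ZMod q) F] [CharP F q] [NeZero g] in
/-- `j ∈ orbit j`. [folklore] -/
theorem mem_orbit_self (j : ZMod g) : j ∈ orbit q j :=
  Finset.mem_image.mpr ⟨0, Finset.mem_range.mpr (Nat.succ_pos _), by rw [pow_zero, one_mul]⟩

omit [Algebra (ZMod q) F] [CharP F q] in
/-- every power `q^k j` lies in `orbit j`. [folklore] -/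
theorem pow_mul_mem_orbit (hqg : ¬ q ∣ g) (j : ZMod g) (k : ℕ) : ((q : ZMod g) ^ k) * j ∈ orbit q j := by
  obtain ⟨N, hN, hqN⟩ := exists_pow_q_eq_one hqg
  -- the order of `q` is at most `g`, so `k mod N'` with `N' = orderOf` works; we use `N ≤ g`? No:
  -- reduce `k` modulo `N` and bound `N` by the cardinality of the unit group `≤ g`.
  set u : (ZMod g)ˣ := ZMod.unitOfCoprime q (coprime_q hqg) with hu
  have hcast : (q : ZMod g) = (u : ZMod g) := by rw [hu, ZMod.coe_unitOfCoprime]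
  have hle : orderOf u ≤ g := by
    calc orderOf u ≤ Fintype.card (ZMod g)ˣ := orderOf_le_card_univ
      _ ≤ Fintype.card (ZMod g) := Fintype.card_le_of_injective _ Units.val_injective
      _ = g := ZMod.card g
  refine Finset.mem_image.mpr ⟨k % orderOf u, Finset.mem_range.mpr ?_, ?_⟩
  · have := Nat.mod_lt k (orderOf_pos u); omega
  · rw [hcast, ← Units.val_pow_eq_pow_val, ← Units.val_pow_eq_pow_val, pow_mod_orderOf]

omit [Algebra (ZMod q) F] [CharP F q] in
/-- membership in an orbit. [folklore] -/
theorem mem_orbit_iff (hqg : ¬ q ∣ g) {j x : ZMod g} : x ∈ orbit q j ↔ ∃ k : ℕ, x = ((q : ZMod g) ^ k) * j := by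
  constructor
  · intro h
    obtain ⟨k, -, rfl⟩ := Finset.mem_image.mp h
    exact ⟨k, rfl⟩
  · rintro ⟨k, rfl⟩
    exact pow_mul_mem_orbit hqg j k

omit [Algebra (ZMod q) F] [CharP F q] in
/-- orbits are stable under `j ↦ q j`. [folklore] -/
theorem q_mul_mem_orbit (hqg : ¬ q ∣ g) {j j' : ZMod g} (h : j' ∈ orbit q j) : (q : ZMod g) * j' ∈ orbit q j := by
  obtain ⟨k, rfl⟩ := (mem_orbit_iff hqg).mp h
  rw [← mul_assoc, ← pow_succ']
  exact pow_mul_mem_orbit hqg j (k + 1)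

omit [Algebra (ZMod q) F] [CharP F q] in
/-- orbits of members coincide. [folklore] -/
theorem orbit_eq_of_mem (hqg : ¬ q ∣ g) {j j' : ZMod g} (h : j' ∈ orbit q j) : orbit q j' = orbit q j := by
  obtain ⟨k, rfl⟩ := (mem_orbit_iff hqg).mp h
  obtain ⟨N, hN, hqN⟩ := exists_pow_q_eq_one hqg
  ext x
  rw [mem_orbit_iff hqg, mem_orbit_iff hqg]
  constructor
  · rintro ⟨m, rfl⟩
    exact ⟨m + k, by rw [pow_add, mul_assoc]⟩
  · rintro ⟨m, rfl⟩
    -- `j = q^t (q^k j)` with `t + k` a multiple of `N`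
    have hk : k < N * (k + 1) := by nlinarith
    refine ⟨m + (N * (k + 1) - k), ?_⟩
    rw [pow_add, mul_assoc, ← mul_assoc ((q : ZMod g) ^ (N * (k + 1) - k)), ← pow_add,
      Nat.sub_add_cancel hk.le, pow_mul, hqN, one_pow, one_mul]

variable {ω : F} (hω : IsPrimitiveRoot ω g) {ρ₀ : ZMod g → Matrix n n (ZMod q)}

include hω in
omit [DecidableEq n] in
/-- if `P_j v ≠ 0` for a Frobenius-fixed `v`, then `P_{q^k j} v ≠ 0` for all `k`.
[cite: Schoof2009, Ch. 13 (p. 86)] -/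
theorem proj_pow_mul_mulVec_ne_zero {v : n → F} (hv : frobVec q v = v) {j : ZMod g}
    (hj : (proj (rhoF F ρ₀) ω j).mulVec v ≠ 0) (k : ℕ) :
    (proj (rhoF F ρ₀) ω (((q : ZMod g) ^ k) * j)).mulVec v ≠ 0 := by
  induction k with
  | zero => rwa [pow_zero, one_mul]
  | succ k ih =>
    intro h0
    apply ih
    rw [← frobVec_eq_zero_iff (q := q), frobVec_proj_mulVec hω ρ₀, hv, ← mul_assoc, ← pow_succ']
    exact h0

include hω in
omit [DecidableEq n] in
/-- … hence `P_{j'} v ≠ 0` on the whole orbit of `j`. [cite: Schoof2009, Ch. 13 (p. 86)] -/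
theorem proj_mulVec_ne_zero_of_mem_orbit (hqg : ¬ q ∣ g) {v : n → F} (hv : frobVec q v = v) {j : ZMod g}
    (hj : (proj (rhoF F ρ₀) ω j).mulVec v ≠ 0) {j' : ZMod g} (hj' : j' ∈ orbit q j) :
    (proj (rhoF F ρ₀) ω j').mulVec v ≠ 0 := by
  obtain ⟨k, rfl⟩ := (mem_orbit_iff hqg).mp hj'
  exact proj_pow_mul_mulVec_ne_zero hω hv hj k

variable (hρ : ∀ a b, ρ₀ (a + b) = ρ₀ a * ρ₀ b) (hρ0 : ρ₀ 0 = 1)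
  (htr : ∀ a : ZMod g, (ρ₀ a).trace = if a = 0 then (g : ZMod q) else 0)

include hρ in
omit [DecidableEq n] [CharP F q] [NeZero g] in
/-- `ρ_F` is multiplicative. [folklore] -/
theorem rhoF_add (a b : ZMod g) : rhoF F ρ₀ (a + b) = rhoF F ρ₀ a * rhoF F ρ₀ b := by
  show (ρ₀ (a + b)).map _ = (ρ₀ a).map _ * (ρ₀ b).map _
  rw [hρ, Matrix.map_mul]

include hρ0 in
omit [CharP F q] [Fintype n] [NeZero g] in
/-- `ρ_F(0) = 1`. [folklore] -/
theorem rhoF_zero : rhoF F ρ₀ 0 = 1 := by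
  show (ρ₀ 0).map _ = 1
  rw [hρ0, Matrix.map_one _ (map_zero _) (map_one _)]

include htr in
omit [DecidableEq n] [CharP F q] [NeZero g] in
/-- `ρ_F` has the regular character. [folklore] -/
theorem rhoF_trace (a : ZMod g) : (rhoF F ρ₀ a).trace = if a = 0 then (g : F) else 0 := by
  show ((ρ₀ a).map _).trace = _
  have e : ((ρ₀ a).map (algebraMap (ZMod q) F)).trace = algebraMap (ZMod q) F (ρ₀ a).trace := by
    simp only [Matrix.trace, Matrix.diag, Matrix.map_apply, map_sum]
  rw [e, htr]
  split_ifs <;> simp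

omit [NeZero g] [CharP F q] in
/-- `g ≠ 0` in `F`. [folklore] -/
theorem g_ne_zero (hqg : ¬ q ∣ g) : (g : F) ≠ 0 := by
  rw [← map_natCast (algebraMap (ZMod q) F), map_ne_zero, Ne, ZMod.natCast_eq_zero_iff]
  exact hqg

include hω hρ htr in
/-- **An `𝔽_q`-rational vector seen by every projector**: there is `w ∈ 𝔽_q^n` with `P_j w ≠ 0` for
all `j` (sum, over the Frobenius orbits `J`, of `Q_J e_{i(J)}` with `Q_J = ∑_{j∈J} P_j` rational and
`Q_J e_{i(J)} ≠ 0`). [cite: Schoof2009, Proposition 13.7 (proof), Ch. 13 (p. 86)] -/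
theorem exists_forall_proj_mulVec_ne_zero (hqg : ¬ q ∣ g) :
    ∃ w₀ : n → ZMod q, ∀ j : ZMod g,
      (proj (rhoF F ρ₀) ω j).mulVec (fun i => algebraMap (ZMod q) F (w₀ i)) ≠ 0 := by
  classical
  haveI : ExpChar F q := ExpChar.prime hq.out
  haveI : Nonempty n := by
    by_contra hn
    rw [not_nonempty_iff] at hn
    have h0 := htr 0
    simp only [if_true, Matrix.trace, Finset.univ_eq_empty, Finset.sum_empty] at h0
    exact hqg ((ZMod.natCast_eq_zero_iff g q).mp h0.symm)
  have hg := g_ne_zero (F := F) hqg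
  have hρF := rhoF_add (F := F) hρ
  obtain ⟨N, hN, hqN⟩ := exists_pow_q_eq_one hqg
  set P : ZMod g → Matrix n n F := proj (rhoF F ρ₀) ω with hPdef
  -- the orbit sums `Q J`
  set Q : Finset (ZMod g) → Matrix n n F := fun J => ∑ j ∈ J, P j with hQdef
  set Ω : Finset (Finset (ZMod g)) := Finset.univ.image (orbit q) with hΩ
  -- `P j * Q J = P j` for `j ∈ J`, `= 0` for `j ∉ J`
  have hPQ : ∀ J, ∀ j, P j * Q J = if j ∈ J then P j else 0 := by
    intro J j
    simp only [hQdef, Finset.mul_sum]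
    simp_rw [hPdef, proj_mul_proj hω hρF hg]
    rw [Finset.sum_ite_eq]
  -- every `Q J`, `J ∈ Ω`, is non-zero, so some column `Q J e_i` is non-zero
  have hQcol : ∀ J ∈ Ω, ∃ i : n, (Q J).mulVec (Pi.single i 1) ≠ 0 := by
    intro J hJ
    obtain ⟨j₀, -, rfl⟩ := Finset.mem_image.mp hJ
    by_contra hall
    push Not at hall
    have hQ0 : Q (orbit q j₀) = 0 := by
      ext i l
      have := congrFun (hall l) i
      simpa using this
    have h1 := hPQ (orbit q j₀) j₀
    rw [hQ0, Matrix.mul_zero, if_pos (mem_orbit_self j₀)] at h1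
    exact proj_ne_zero (ω := ω) hg (rhoF_trace (F := F) htr) j₀ h1.symm
  choose! idx hidx using hQcol
  -- the vector
  set w : n → F := ∑ J ∈ Ω, (Q J).mulVec (Pi.single (idx J) 1) with hwdef
  -- `Q J e_i` is Frobenius-fixed for every orbit `J`
  have hfrobQ : ∀ J ∈ Ω, ∀ i : n,
      frobVec q ((Q J).mulVec (Pi.single i 1)) = (Q J).mulVec (Pi.single i 1) := by
    intro J hJ i
    obtain ⟨j₀, -, rfl⟩ := Finset.mem_image.mp hJ
    simp only [hQdef, Matrix.sum_mulVec]
    have e1 : frobVec q (∑ j ∈ orbit q j₀, (P j).mulVec (Pi.single i 1)) =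
        ∑ j ∈ orbit q j₀, frobVec q ((P j).mulVec (Pi.single i 1)) := by
      funext l
      simp only [frobVec, Finset.sum_apply]
      rw [sum_pow_char]
    rw [e1]
    simp_rw [hPdef, frobVec_proj_mulVec hω ρ₀, frobVec_single]
    -- reindex the orbit by `j ↦ q j`
    apply Finset.sum_nbij (fun j => (q : ZMod g) * j)
    · intro j hj; exact q_mul_mem_orbit hqg hj
    · intro j _ j' _ h
      have hu : IsUnit (q : ZMod g) := by
        rw [← ZMod.coe_unitOfCoprime q (coprime_q hqg)]; exact Units.isUnit _
      exact hu.mul_left_cancel h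
    · intro j' hj'
      refine ⟨((q : ZMod g) ^ (N - 1)) * j', ?_, ?_⟩
      · have := pow_mul_mem_orbit hqg j' (N - 1)
        rw [orbit_eq_of_mem hqg (Finset.mem_coe.mp hj')] at this
        exact this
      · show (q : ZMod g) * (((q : ZMod g) ^ (N - 1)) * j') = j'
        rw [← mul_assoc, ← pow_succ', Nat.sub_add_cancel hN, hqN, one_mul]
    · intro j _; rfl
  have hwfrob : frobVec q w = w := by
    rw [hwdef]
    have e1 : frobVec q (∑ J ∈ Ω, (Q J).mulVec (Pi.single (idx J) 1)) =
        ∑ J ∈ Ω, frobVec q ((Q J).mulVec (Pi.single (idx J) 1)) := by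
      funext l
      simp only [frobVec, Finset.sum_apply]
      rw [sum_pow_char]
    rw [e1]
    exact Finset.sum_congr rfl fun J hJ => hfrobQ J hJ _
  obtain ⟨w₀, hw₀⟩ := exists_eq_algebraMap_of_frobVec_eq hwfrob
  refine ⟨w₀, fun j => ?_⟩
  rw [← hw₀]
  -- `P_j w = P_j e_{i(J)}` for the orbit `J ∋ j`
  have hJmem : orbit q j ∈ Ω := Finset.mem_image.mpr ⟨j, Finset.mem_univ _, rfl⟩
  have hPw : (P j).mulVec w = (P j).mulVec (Pi.single (idx (orbit q j)) 1) := by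
    rw [hwdef, Matrix.mulVec_sum]
    simp_rw [Matrix.mulVec_mulVec]
    rw [Finset.sum_eq_single (orbit q j)]
    · rw [hPQ, if_pos (mem_orbit_self j)]
    · intro J hJ hne
      rw [hPQ J, if_neg, Matrix.zero_mulVec]
      intro hjJ
      apply hne
      obtain ⟨j₀, -, rfl⟩ := Finset.mem_image.mp hJ
      exact (orbit_eq_of_mem hqg hjJ).symm
    · intro h; exact absurd hJmem h
  rw [hPw]
  -- some `P_{j₀} e_i ≠ 0` with `j₀` in the orbit of `j`, and then all of them
  have hne : (Q (orbit q j)).mulVec (Pi.single (idx (orbit q j)) 1) ≠ 0 := hidx _ hJmem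
  have hex : ∃ j₀ ∈ orbit q j, (P j₀).mulVec (Pi.single (idx (orbit q j)) 1) ≠ 0 := by
    by_contra hall
    push Not at hall
    apply hne
    simp only [hQdef, Matrix.sum_mulVec]
    exact Finset.sum_eq_zero hall
  obtain ⟨j₀, hj₀, hP0⟩ := hex
  have hjmem : j ∈ orbit q j₀ := by rw [orbit_eq_of_mem hqg hj₀]; exact mem_orbit_self j
  exact proj_mulVec_ne_zero_of_mem_orbit hω hqg (frobVec_single _) hP0 hjmem

/-! ### The main theorem -/

include hρ htr in
omit [CharP F q] [Algebra (ZMod q) F] [Field F] in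
/-- **A representation of `ℤ/g` over `𝔽_q` (`q ∤ g` prime) with the regular character is regular**
(the `𝔽_q`-kernel of [Schoof2009, Corollary 13.5 / Proposition 13.7]): if `ρ(0) = 1`,
`ρ(a + b) = ρ(a)ρ(b)` and `tr ρ(a) = g·[a = 0]`, then for some `w ∈ 𝔽_q^n` the vectors `ρ(a) w`,
`a ∈ ℤ/g`, are linearly independent over `𝔽_q`; so `𝔽_q[ℤ/g] → 𝔽_q^n`, `θ ↦ θ·w` is injective, and
bijective when `#n = g`, i.e. `𝔽_q^n` is the free `𝔽_q[ℤ/g]`-module of rank one generated by `w`.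
The auxiliary field `F ⊇ 𝔽_q` with a primitive `g`-th root of unity exists because `q ∤ g`
(e.g. `F = 𝔽_q(μ_g)`); it is a parameter here. [cite: Schoof2009, Corollary 13.5, Proposition 13.7 (proof)] -/
theorem exists_linearIndependent_mulVec (hqg : ¬ q ∣ g) (F : Type*) [Field F] [Algebra (ZMod q) F]
    [CharP F q] {ω : F} (hω : IsPrimitiveRoot ω g) :
    ∃ w : n → ZMod q, LinearIndependent (ZMod q) (fun a : ZMod g => (ρ₀ a).mulVec w) := by
  classical
  have hg := g_ne_zero (F := F) hqg
  have hρF := rhoF_add (F := F) hρ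
  obtain ⟨w₀, hw₀⟩ := exists_forall_proj_mulVec_ne_zero (F := F) hω hρ htr hqg
  refine ⟨w₀, ?_⟩
  rw [Fintype.linearIndependent_iff]
  intro c hc b
  set φ := algebraMap (ZMod q) F with hφ
  set w : n → F := fun i => φ (w₀ i) with hw
  -- push the relation to `F`
  have hcF : ∑ a : ZMod g, φ (c a) • (rhoF F ρ₀ a).mulVec w = 0 := by
    funext i
    have h := congrArg φ (congrFun hc i)
    simp only [Finset.sum_apply, Pi.smul_apply, smul_eq_mul, map_sum, map_mul, Pi.zero_apply,
      map_zero] at h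
    simp only [Finset.sum_apply, Pi.smul_apply, smul_eq_mul, Pi.zero_apply]
    rw [← h]
    refine Finset.sum_congr rfl fun a _ => ?_
    congr 1
    rw [RingHom.map_mulVec]
    rfl
  -- apply `P_j`: all Fourier coefficients vanish
  have hcoef : ∀ j : ZMod g, ∑ a : ZMod g, φ (c a) * chi ω j a = 0 := by
    intro j
    have h := congrArg ((proj (rhoF F ρ₀) ω j).mulVec) hcF
    rw [Matrix.mulVec_zero, Matrix.mulVec_sum] at h
    simp_rw [Matrix.mulVec_smul, Matrix.mulVec_mulVec, proj_mul hω hρF, Matrix.smul_mulVec,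
      smul_smul, ← Finset.sum_smul] at h
    exact (smul_eq_zero.mp h).resolve_right (hw₀ j)
  have hczero := eq_zero_of_forall_sum_chi_eq_zero hω hg hcoef
  have := congrFun hczero b
  simp only [Pi.zero_apply, map_eq_zero] at this
  exact this

include hρ htr in
omit [CharP F q] [Algebra (ZMod q) F] [Field F] in
/-- **A representation of `ℤ/g` over `𝔽_q` with the regular character is regular** — the same
statement with the auxiliary splitting field chosen as `𝔽_q(μ_g)` (Mathlib's `CyclotomicField g 𝔽_q`,
which exists as `q ∤ g`). [cite: Schoof2009, Corollary 13.5, Proposition 13.7 (proof)] -/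
theorem exists_linearIndependent_mulVec' (hqg : ¬ q ∣ g) :
    ∃ w : n → ZMod q, LinearIndependent (ZMod q) (fun a : ZMod g => (ρ₀ a).mulVec w) := by
  haveI : NeZero ((g : ℕ) : ZMod q) := ⟨by rw [Ne, ZMod.natCast_eq_zero_iff]; exact hqg⟩
  haveI : CharP (CyclotomicField g (ZMod q)) q :=
    charP_of_injective_algebraMap (algebraMap (ZMod q) (CyclotomicField g (ZMod q))).injective q
  exact exists_linearIndependent_mulVec hρ htr hqg (CyclotomicField g (ZMod q))
    (IsCyclotomicExtension.zeta_spec g (ZMod q) (CyclotomicField g (ZMod q)))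

end Orbits

end Catalan.Semisimple

end Literature.NumberTheory.DiophantineGeometry
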